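import Literature.AnabelianGeometry.SemiGraphs.TemperedInductionFibrewise
import Literature.AnabelianGeometry.SemiGraphs.TemperoidsResProofs
import Literature.AlgebraicGeometry.Frobenioids.QuasiTemperoidInductionFunctor
import Mathlib.Topology.Algebra.OpenSubgroup
import HarnessLib

/-!
# Point fibres: `B^temp(Π)_X ≌ ∏_ω B^temp(Stab(x_ω))`, explicitly

Mochizuki, *Semi-graphs of anabelioids*, Publ. RIMS **42** (2006) [cite: MochizukiSemiAnbd2006, §3
pp.37-39]. Infrastructure for Proposition 3.6 (v) (`EtaleOfTemperedCovering`, file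
`TemperedReconstruction`): for `X ∈ B^temp(Π)` with chosen base points `x_ω = Quot.out ω` of its
`Π`-orbits `ω`, the functor

  `fibreFamily X : Over X ⥤ ∀ ω, B^temp(Stab(x_ω))`, `(T → X) ↦ (T ×_X {x_ω})_ω`,

taking an object over `X` to the family of its point fibres (with the stabiliser actions) is an
EXPLICIT equivalence of categories: faithful and full (a `Π`-map over `X` is recovered from its
restrictions to the base-point fibres by translation), and essentially surjective (the family
`(Y_ω)_ω` is the fibre family of `∐_ω Π ×^{Stab(x_ω)} Y_ω → X`, built from the induction functor of
`QuasiTemperoidInductionFunctor`). This is the §2/§3 dictionary "objects over `X` = objects over the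
connected components of `X`, i.e. over the anabelioids `B(Stab)`" (p. 23, p. 37) at the level of
`B^temp`, in the explicit form needed to glue along the branches of a semi-graph.
-/

noncomputable section

open CategoryTheory Topology

namespace Literature.AnabelianGeometry.SemiGraphs

open Literature.AlgebraicGeometry.Frobenioids.QuasiTemperoid.BTempConnected (hom_ρ hom_ext_apply
  ρ_one_apply ρ_mul_apply ρ_inv_apply)
open Literature.AlgebraicGeometry.Frobenioids.QuasiTemperoid (inducedMk inducedMk_eq_iff
  inducedMk_mul inducedObj inducedObj_ρ_mk InducedSet inducedLift inducedLift_mk)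

universe u

namespace BTemp

variable {G : Type u} [Group G] [TopologicalSpace G]

/-! ### The fibre of an object over `X` at a point, as a `Stab(x)`-set -/

/-- The points of `T → X` over the point `x`. [cite: MochizukiSemiAnbd2006, Def 3.5(i) p.37] -/
abbrev PtFibre {X : BTemp G} (T : Over X) (x : X.obj.V) : Type u :=
  {t : T.left.obj.V // T.hom.hom.hom t = x}

/-- The stabiliser of `x` preserves the fibre over `x`. [cite: MochizukiSemiAnbd2006, Def 3.5(i) p.37] -/
theorem hom_ρ_stab {X : BTemp G} (T : Over X) (x : X.obj.V) (h : stab X x) (t : PtFibre T x) :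
    (T.hom.hom.hom (T.left.obj.ρ (h : G) t.1) : X.obj.V) = x := by
  rw [hom_ρ, t.2]
  exact h.2

/-- **The point fibre** `T_x = T ×_X {x}` of `T → X` as an object of `B^temp(Stab(x))` (the
"connected component" dictionary of §2 p. 23 / Def. 3.5 (i) p. 37: over the component of `x`, an
object over `X` is a `Stab(x)`-set). [cite: MochizukiSemiAnbd2006, Def 3.5(i) p.37] -/
def ptFibre {X : BTemp G} (T : Over X) (x : X.obj.V) : BTemp (stab X x) :=
  letI : MulAction (stab X x) (PtFibre T x) :=
    { smul := fun h t => ⟨T.left.obj.ρ (h : G) t.1, hom_ρ_stab T x h t⟩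
      one_smul := fun t => Subtype.ext (ρ_one_apply T.left t.1)
      mul_smul := fun h h' t => Subtype.ext (ρ_mul_apply T.left (h : G) (h' : G) t.1) }
  ⟨Action.ofMulAction (stab X x) (PtFibre T x), by
    haveI : Countable T.left.obj.V := T.left.property.1
    refine ⟨inferInstanceAs (Countable (PtFibre T x)), fun t => ?_⟩
    have : {h : stab X x | (Action.ofMulAction (stab X x) (PtFibre T x)).ρ h t = t} =
        Subtype.val ⁻¹' {g : G | T.left.obj.ρ g t.1 = t.1} := by
      ext h
      exact Subtype.ext_iff
    rw [this]
    exact (T.left.property.2 t.1).preimage continuous_subtype_val⟩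

/-- The action on a point fibre, on points. [cite: MochizukiSemiAnbd2006, Def 3.5(i) p.37] -/
theorem ptFibre_ρ {X : BTemp G} (T : Over X) (x : X.obj.V) (h : stab X x) (t : PtFibre T x) :
    ((ptFibre T x).obj.ρ h t).1 = T.left.obj.ρ (h : G) t.1 :=
  rfl

/-- A morphism over `X` preserves the fibres over `x`. [cite: MochizukiSemiAnbd2006, Def 3.5(i) p.37] -/
theorem over_w_apply {X : BTemp G} {T T' : Over X} (f : T ⟶ T') (t : T.left.obj.V) :
    (T'.hom.hom.hom (f.left.hom.hom t) : X.obj.V) = T.hom.hom.hom t :=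
  congrArg (fun k : T.left ⟶ X => (k.hom.hom t : X.obj.V)) (Over.w f)

/-- The point-fibre functor on morphisms. [cite: MochizukiSemiAnbd2006, Def 3.5(i) p.37] -/
def ptFibreMap {X : BTemp G} {T T' : Over X} (f : T ⟶ T') (x : X.obj.V) :
    ptFibre T x ⟶ ptFibre T' x :=
  ObjectProperty.homMk
    { hom := TypeCat.ofHom fun t : PtFibre T x =>
        (⟨f.left.hom.hom t.1, (over_w_apply f t.1).trans t.2⟩ : PtFibre T' x)
      comm := fun h => by
        apply ConcreteCategory.hom_ext
        intro t
        apply Subtype.ext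
        exact hom_ρ f.left (h : G) t.1 }

/-- The point-fibre functor on morphisms, on points. [cite: MochizukiSemiAnbd2006, Def 3.5(i) p.37] -/
theorem ptFibreMap_apply {X : BTemp G} {T T' : Over X} (f : T ⟶ T') (x : X.obj.V) (t : PtFibre T x) :
    ((ptFibreMap f x).hom.hom t).1 = f.left.hom.hom t.1 :=
  rfl

/-! ### The fibre-family functor `Over X ⥤ ∏_ω B^temp(Stab(x_ω))` -/

/-- **The fibre-family functor** `T ↦ (T_{x_ω})_ω`, `x_ω = Quot.out ω` the chosen base point of the
orbit `ω`. [cite: MochizukiSemiAnbd2006, Prop 3.6(v) p.39] -/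
def fibreFamily (X : BTemp G) : Over X ⥤ ∀ ω : Orbits X, BTemp (stab X (Quot.out ω)) where
  obj T := fun ω => ptFibre T (Quot.out ω)
  map f := fun ω => ptFibreMap f (Quot.out ω)
  map_id T := by
    funext ω
    exact hom_ext_apply fun t => rfl
  map_comp f g := by
    funext ω
    exact hom_ext_apply fun t => rfl

/-- The fibre-family functor on morphisms, on points. [cite: MochizukiSemiAnbd2006, Prop 3.6(v) p.39] -/
theorem fibreFamily_map_apply {X : BTemp G} {T T' : Over X} (f : T ⟶ T') (ω : Orbits X)
    (t : PtFibre T (Quot.out ω)) :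
    (((fibreFamily X).map f ω).hom.hom t).1 = f.left.hom.hom t.1 :=
  rfl

/-- A chosen translation `γ_s ∈ Π` from the base point of the orbit of `s` to `s`:
`γ_s · x_{[s]} = s`. [cite: MochizukiSemiAnbd2006, Prop 3.6(v) p.39] -/
def sec (X : BTemp G) (s : X.obj.V) : G :=
  Classical.choose ((cl_eq_cl_iff X (Quot.out (cl X s)) s).mp (Quot.out_eq (cl X s)))

/-- The defining property of `sec`. [cite: MochizukiSemiAnbd2006, Prop 3.6(v) p.39] -/
theorem ρ_sec (X : BTemp G) (s : X.obj.V) : X.obj.ρ (sec X s) (Quot.out (cl X s)) = s :=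
  Classical.choose_spec ((cl_eq_cl_iff X (Quot.out (cl X s)) s).mp (Quot.out_eq (cl X s)))

/-- `γ_s⁻¹ · s` is the base point of the orbit of `s`. [cite: MochizukiSemiAnbd2006, Prop 3.6(v) p.39] -/
theorem ρ_sec_inv (X : BTemp G) (s : X.obj.V) : X.obj.ρ (sec X s)⁻¹ s = Quot.out (cl X s) := by
  have h : X.obj.ρ (sec X s)⁻¹ (X.obj.ρ (sec X s) (Quot.out (cl X s))) = Quot.out (cl X s) :=
    ρ_inv_apply X _ _
  rwa [ρ_sec] at h

/-- The translate `γ_s⁻¹ · t` of a point `t` of `T` over `s` lies in the base-point fibre of the orbit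
of `s`. [cite: MochizukiSemiAnbd2006, Prop 3.6(v) p.39] -/
def toBaseFibre {X : BTemp G} (T : Over X) (t : T.left.obj.V) :
    PtFibre T (Quot.out (cl X (T.hom.hom.hom t))) :=
  ⟨T.left.obj.ρ (sec X (T.hom.hom.hom t))⁻¹ t, by rw [hom_ρ, ρ_sec_inv]⟩

/-- `fibreFamily X` is faithful: a morphism over `X` is determined by its restrictions to the
base-point fibres (translate any point into one). [cite: MochizukiSemiAnbd2006, Prop 3.6(v) p.39] -/
instance fibreFamily_faithful (X : BTemp G) : (fibreFamily X).Faithful :=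
  ⟨fun {T T'} {f f'} h => by
    apply Over.OverMorphism.ext
    apply hom_ext_apply
    intro t
    have e := congrArg (fun k => ((k (cl X (T.hom.hom.hom t))).hom.hom (toBaseFibre T t)).1) h
    change f.left.hom.hom (T.left.obj.ρ _ t) = f'.left.hom.hom (T.left.obj.ρ _ t) at e
    rw [hom_ρ, hom_ρ] at e
    have e' := congrArg (T'.left.obj.ρ (sec X (T.hom.hom.hom t))) e
    rwa [← ρ_mul_apply, ← ρ_mul_apply, mul_inv_cancel, ρ_one_apply, ρ_one_apply] at e'⟩

/-- The glued map of a family of maps of base-point fibres: `t ↦ γ_s · φ_{[s]}(γ_s⁻¹ · t)` for `t`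
over `s`. [cite: MochizukiSemiAnbd2006, Prop 3.6(v) p.39] -/
def glueMap {X : BTemp G} {T T' : Over X}
    (φ : (fibreFamily X).obj T ⟶ (fibreFamily X).obj T') (t : T.left.obj.V) : T'.left.obj.V :=
  T'.left.obj.ρ (sec X (T.hom.hom.hom t)) ((φ (cl X (T.hom.hom.hom t))).hom.hom (toBaseFibre T t)).1

/-- The glued map at `t`, computed from ANY presentation `t = g · x` with `x` in a base-point fibre
(independence of the chosen translations). [cite: MochizukiSemiAnbd2006, Prop 3.6(v) p.39] -/
theorem glueMap_eq_of {X : BTemp G} {T T' : Over X}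
    (φ : (fibreFamily X).obj T ⟶ (fibreFamily X).obj T') (t : T.left.obj.V) (ω : Orbits X)
    (hω : cl X (T.hom.hom.hom t) = ω) (x : PtFibre T (Quot.out ω)) (g : G)
    (hx : T.left.obj.ρ g x.1 = t) :
    glueMap φ t = T'.left.obj.ρ g ((φ ω).hom.hom x).1 := by
  subst hω
  have hst : X.obj.ρ g (Quot.out (cl X (T.hom.hom.hom t))) = T.hom.hom.hom t := by
    rw [← x.2, ← hom_ρ, hx]
  -- `k := γ⁻¹ g` stabilises the base point
  have hk : X.obj.ρ ((sec X (T.hom.hom.hom t))⁻¹ * g) (Quot.out (cl X (T.hom.hom.hom t))) =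
      Quot.out (cl X (T.hom.hom.hom t)) := by
    rw [ρ_mul_apply, hst, ρ_sec_inv]
  let k : stab X (Quot.out (cl X (T.hom.hom.hom t))) := ⟨_, hk⟩
  have e1 : toBaseFibre T t = ((fibreFamily X).obj T (cl X (T.hom.hom.hom t))).obj.ρ k x := by
    apply Subtype.ext
    change T.left.obj.ρ (sec X (T.hom.hom.hom t))⁻¹ t = T.left.obj.ρ ((sec X (T.hom.hom.hom t))⁻¹ * g) x.1
    rw [ρ_mul_apply, hx]
  change T'.left.obj.ρ (sec X (T.hom.hom.hom t))
      (((φ (cl X (T.hom.hom.hom t))).hom.hom (toBaseFibre T t)).1) = _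
  rw [e1, hom_ρ (φ (cl X (T.hom.hom.hom t))) k x]
  change T'.left.obj.ρ (sec X (T.hom.hom.hom t))
      (T'.left.obj.ρ ((sec X (T.hom.hom.hom t))⁻¹ * g) ((φ (cl X (T.hom.hom.hom t))).hom.hom x).1) = _
  rw [← ρ_mul_apply, ← mul_assoc, mul_inv_cancel, one_mul]

/-- The glued map on a translate `g · x` of a base-fibre point `x` is `g · φ(x)`.
[cite: MochizukiSemiAnbd2006, Prop 3.6(v) p.39] -/
theorem glueMap_eq {X : BTemp G} {T T' : Over X}
    (φ : (fibreFamily X).obj T ⟶ (fibreFamily X).obj T') (ω : Orbits X)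
    (x : PtFibre T (Quot.out ω)) (g : G) :
    glueMap φ (T.left.obj.ρ g x.1) = T'.left.obj.ρ g ((φ ω).hom.hom x).1 :=
  glueMap_eq_of φ _ ω (by rw [hom_ρ, x.2, cl_ρ]; exact Quot.out_eq ω) x g rfl

/-- On a base-point fibre the glued map is the given map. [cite: MochizukiSemiAnbd2006, Prop 3.6(v) p.39] -/
theorem glueMap_base {X : BTemp G} {T T' : Over X}
    (φ : (fibreFamily X).obj T ⟶ (fibreFamily X).obj T') (ω : Orbits X)
    (x : PtFibre T (Quot.out ω)) : glueMap φ x.1 = ((φ ω).hom.hom x).1 := by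
  have e := glueMap_eq φ ω x 1
  rwa [ρ_one_apply, ρ_one_apply] at e

/-- The glued map is `Π`-equivariant. [cite: MochizukiSemiAnbd2006, Prop 3.6(v) p.39] -/
theorem glueMap_ρ {X : BTemp G} {T T' : Over X}
    (φ : (fibreFamily X).obj T ⟶ (fibreFamily X).obj T') (g : G) (t : T.left.obj.V) :
    glueMap φ (T.left.obj.ρ g t) = T'.left.obj.ρ g (glueMap φ t) := by
  set s := T.hom.hom.hom t with hs
  have ht : T.left.obj.ρ (sec X s) (toBaseFibre T t).1 = t := by
    change T.left.obj.ρ (sec X s) (T.left.obj.ρ (sec X s)⁻¹ t) = t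
    rw [← ρ_mul_apply, mul_inv_cancel, ρ_one_apply]
  calc glueMap φ (T.left.obj.ρ g t)
      = glueMap φ (T.left.obj.ρ (g * sec X s) (toBaseFibre T t).1) := by rw [ρ_mul_apply, ht]
    _ = T'.left.obj.ρ (g * sec X s) (((φ _).hom.hom (toBaseFibre T t)).1) := glueMap_eq φ _ _ _
    _ = T'.left.obj.ρ g (T'.left.obj.ρ (sec X s) (((φ _).hom.hom (toBaseFibre T t)).1)) :=
        ρ_mul_apply _ _ _ _
    _ = T'.left.obj.ρ g (glueMap φ (T.left.obj.ρ (sec X s) (toBaseFibre T t).1)) := by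
        rw [glueMap_eq φ _ (toBaseFibre T t) (sec X s)]
    _ = T'.left.obj.ρ g (glueMap φ t) := by rw [ht]

/-- The glued map lies over `X`. [cite: MochizukiSemiAnbd2006, Prop 3.6(v) p.39] -/
theorem hom_glueMap {X : BTemp G} {T T' : Over X}
    (φ : (fibreFamily X).obj T ⟶ (fibreFamily X).obj T') (t : T.left.obj.V) :
    (T'.hom.hom.hom (glueMap φ t) : X.obj.V) = T.hom.hom.hom t := by
  unfold glueMap
  rw [hom_ρ, ((φ (cl X (T.hom.hom.hom t))).hom.hom (toBaseFibre T t)).2, ρ_sec]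

/-- The glued morphism over `X`. [cite: MochizukiSemiAnbd2006, Prop 3.6(v) p.39] -/
def glueHom {X : BTemp G} {T T' : Over X}
    (φ : (fibreFamily X).obj T ⟶ (fibreFamily X).obj T') : T ⟶ T' :=
  Over.homMk (ObjectProperty.homMk
    { hom := TypeCat.ofHom (glueMap φ)
      comm := fun g => by
        apply ConcreteCategory.hom_ext
        intro t
        exact glueMap_ρ φ g t }) (hom_ext_apply fun t => hom_glueMap φ t)

/-- `fibreFamily X` maps the glued morphism back to the family. [cite: MochizukiSemiAnbd2006, Prop 3.6(v) p.39] -/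
theorem fibreFamily_map_glueHom {X : BTemp G} {T T' : Over X}
    (φ : (fibreFamily X).obj T ⟶ (fibreFamily X).obj T') : (fibreFamily X).map (glueHom φ) = φ := by
  funext ω
  apply hom_ext_apply
  intro x
  apply Subtype.ext
  exact glueMap_base φ ω x

/-- `fibreFamily X` is full. [cite: MochizukiSemiAnbd2006, Prop 3.6(v) p.39] -/
instance fibreFamily_full (X : BTemp G) : (fibreFamily X).Full :=
  ⟨fun φ => ⟨glueHom φ, fibreFamily_map_glueHom φ⟩⟩

/-! ### Essential surjectivity: the induced object `∐_ω Π ×^{Stab(x_ω)} Y_ω → X` -/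

section EssSurj

/-- The inclusion `Stab(x) ↪ Π` is an open map (the stabiliser is open). [cite: MochizukiSemiAnbd2006, §3 p.33] -/
theorem isOpenMap_stab_subtype (X : BTemp G) (x : X.obj.V) :
    IsOpenMap ((stab X x).subtype : stab X x → G) :=
  (X.property.2 x).isOpenMap_subtype_val

variable [IsTopologicalGroup G] (hQ : ∀ U : Subgroup G, IsOpen (U : Set G) → Countable (G ⧸ U))

/-- The induced `Π`-set `Π ×^{Stab(x)} Y ∈ B^temp(Π)` of `Y ∈ B^temp(Stab(x))`.
[cite: MochizukiSemiAnbd2006, Prop 3.6(v) p.39] -/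
def induced (X : BTemp G) (x : X.obj.V) (Y : BTemp (stab X x)) : BTemp G :=
  inducedObj (stab X x).subtype (isOpenMap_stab_subtype X x) hQ Y

/-- The action of the induced object on classes. [cite: MochizukiSemiAnbd2006, Prop 3.6(v) p.39] -/
theorem induced_ρ_mk (X : BTemp G) (x : X.obj.V) (Y : BTemp (stab X x)) (g q : G) (y : Y.obj.V) :
    (induced hQ X x Y).obj.ρ g (inducedMk q y : InducedSet (stab X x).subtype Y) = inducedMk (g * q) y :=
  rfl

/-- The structure map `Π ×^{Stab(x)} Y → X`, `[(q, y)] ↦ q · x`. [cite: MochizukiSemiAnbd2006, Prop 3.6(v) p.39] -/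
def inducedHom (X : BTemp G) (x : X.obj.V) (Y : BTemp (stab X x)) : induced hQ X x Y ⟶ X :=
  ObjectProperty.homMk
    { hom := TypeCat.ofHom (inducedLift (stab X x).subtype continuous_subtype_val
        (ObjectProperty.homMk
          { hom := TypeCat.ofHom fun _ : Y.obj.V => x
            comm := fun h => by
              apply ConcreteCategory.hom_ext
              intro y
              exact h.2.symm } : Y ⟶ (BTemp.res ⟨(stab X x).subtype, continuous_subtype_val⟩).obj X))
      comm := fun g => by
        apply ConcreteCategory.hom_ext
        intro c
        induction c using Quotient.ind with
        | _ p =>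
          change inducedLift _ _ _ ((induced hQ X x Y).obj.ρ g (inducedMk p.1 p.2)) =
            X.obj.ρ g (inducedLift _ _ _ (inducedMk p.1 p.2))
          rw [induced_ρ_mk, inducedLift_mk, inducedLift_mk, ρ_mul_apply] }

/-- The structure map on classes. [cite: MochizukiSemiAnbd2006, Prop 3.6(v) p.39] -/
theorem inducedHom_mk (X : BTemp G) (x : X.obj.V) (Y : BTemp (stab X x)) (q : G) (y : Y.obj.V) :
    ((inducedHom hQ X x Y).hom.hom (inducedMk q y : InducedSet (stab X x).subtype Y) : X.obj.V) =
      X.obj.ρ q x :=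
  rfl

/-- The carrier `∐_ω Π ×^{Stab(x_ω)} Y_ω` of the gluing object. [cite: MochizukiSemiAnbd2006, Prop 3.6(v) p.39] -/
abbrev SigmaCarrier (X : BTemp G) (Y : ∀ ω : Orbits X, BTemp (stab X (Quot.out ω))) : Type u :=
  Σ ω : Orbits X, (induced hQ X (Quot.out ω) (Y ω)).obj.V

/-- **The gluing object** `∐_ω Π ×^{Stab(x_ω)} Y_ω ∈ B^temp(Π)` of a family `(Y_ω)_ω` (a countable
disjoint union of countable `Π`-sets with open stabilisers). [cite: MochizukiSemiAnbd2006, Prop 3.6(v) p.39] -/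
def sigmaInduced (X : BTemp G) (Y : ∀ ω : Orbits X, BTemp (stab X (Quot.out ω))) : BTemp G :=
  letI : ∀ ω : Orbits X, MulAction G (induced hQ X (Quot.out ω) (Y ω)).obj.V := fun ω =>
    Action.instMulAction (induced hQ X (Quot.out ω) (Y ω)).obj
  haveI : Countable X.obj.V := X.property.1
  haveI : ∀ ω : Orbits X, Countable (induced hQ X (Quot.out ω) (Y ω)).obj.V := fun ω =>
    (induced hQ X (Quot.out ω) (Y ω)).property.1
  ⟨Action.ofMulAction G (SigmaCarrier hQ X Y), by
    refine ⟨inferInstanceAs (Countable (SigmaCarrier hQ X Y)), fun p => ?_⟩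
    obtain ⟨ω, c⟩ := p
    have : {g : G | (Action.ofMulAction G (SigmaCarrier hQ X Y)).ρ g (⟨ω, c⟩ : SigmaCarrier hQ X Y) =
          (⟨ω, c⟩ : SigmaCarrier hQ X Y)} =
        {g : G | (induced hQ X (Quot.out ω) (Y ω)).obj.ρ g c = c} := by
      ext g
      simp only [Set.mem_setOf_eq]
      change (⟨ω, g • c⟩ : SigmaCarrier hQ X Y) = ⟨ω, c⟩ ↔ _
      rw [Sigma.mk.inj_iff]
      exact ⟨fun h => eq_of_heq h.2, fun h => ⟨rfl, heq_of_eq h⟩⟩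
    rw [this]
    exact (induced hQ X (Quot.out ω) (Y ω)).property.2 c⟩

/-- The action on the gluing object, on points. [cite: MochizukiSemiAnbd2006, Prop 3.6(v) p.39] -/
theorem sigmaInduced_ρ (X : BTemp G) (Y : ∀ ω : Orbits X, BTemp (stab X (Quot.out ω))) (g : G)
    (ω : Orbits X) (c : (induced hQ X (Quot.out ω) (Y ω)).obj.V) :
    (sigmaInduced hQ X Y).obj.ρ g (⟨ω, c⟩ : SigmaCarrier hQ X Y) =
      (⟨ω, (induced hQ X (Quot.out ω) (Y ω)).obj.ρ g c⟩ : SigmaCarrier hQ X Y) :=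
  rfl

/-- The structure map `∐_ω Π ×^{Stab(x_ω)} Y_ω → X`. [cite: MochizukiSemiAnbd2006, Prop 3.6(v) p.39] -/
def sigmaInducedHom (X : BTemp G) (Y : ∀ ω : Orbits X, BTemp (stab X (Quot.out ω))) :
    sigmaInduced hQ X Y ⟶ X :=
  ObjectProperty.homMk
    { hom := TypeCat.ofHom fun p : SigmaCarrier hQ X Y =>
        ((inducedHom hQ X (Quot.out p.1) (Y p.1)).hom.hom p.2 : X.obj.V)
      comm := fun g => by
        apply ConcreteCategory.hom_ext
        rintro ⟨ω, c⟩
        exact hom_ρ (inducedHom hQ X (Quot.out ω) (Y ω)) g c }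

/-- The gluing object over `X`. [cite: MochizukiSemiAnbd2006, Prop 3.6(v) p.39] -/
def sigmaInducedOver (X : BTemp G) (Y : ∀ ω : Orbits X, BTemp (stab X (Quot.out ω))) : Over X :=
  Over.mk (sigmaInducedHom hQ X Y)

/-- The comparison `Y_ω → (∐ Π ×^{Stab} Y)_{x_ω}`, `y ↦ (ω, [(1, y)])`.
[cite: MochizukiSemiAnbd2006, Prop 3.6(v) p.39] -/
def toSigmaFibre (X : BTemp G) (Y : ∀ ω : Orbits X, BTemp (stab X (Quot.out ω))) (ω : Orbits X) :
    Y ω ⟶ (fibreFamily X).obj (sigmaInducedOver hQ X Y) ω :=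
  ObjectProperty.homMk
    { hom := TypeCat.ofHom fun y : (Y ω).obj.V =>
        (⟨⟨ω, (inducedMk 1 y : InducedSet (stab X (Quot.out ω)).subtype (Y ω))⟩, by
          change X.obj.ρ 1 (Quot.out ω) = Quot.out ω
          exact ρ_one_apply X _⟩ : PtFibre (sigmaInducedOver hQ X Y) (Quot.out ω))
      comm := fun h => by
        apply ConcreteCategory.hom_ext
        intro y
        apply Subtype.ext
        change (⟨ω, (inducedMk 1 ((Y ω).obj.ρ h y) : InducedSet (stab X (Quot.out ω)).subtype (Y ω))⟩ :
            SigmaCarrier hQ X Y) =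
          (sigmaInduced hQ X Y).obj.ρ (h : G) (⟨ω, inducedMk 1 y⟩ : SigmaCarrier hQ X Y)
        rw [sigmaInduced_ρ, induced_ρ_mk, mul_one, ← inducedMk_mul, one_mul]
        rfl }

/-- The comparison is bijective. [cite: MochizukiSemiAnbd2006, Prop 3.6(v) p.39] -/
theorem toSigmaFibre_bijective (X : BTemp G) (Y : ∀ ω : Orbits X, BTemp (stab X (Quot.out ω)))
    (ω : Orbits X) :
    Function.Bijective fun y : (Y ω).obj.V =>
      (((toSigmaFibre hQ X Y ω).hom.hom y) : PtFibre (sigmaInducedOver hQ X Y) (Quot.out ω)) := by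
  constructor
  · intro y y' h
    have h1 := congrArg Subtype.val h
    change (⟨ω, (inducedMk 1 y : InducedSet (stab X (Quot.out ω)).subtype (Y ω))⟩ :
        SigmaCarrier hQ X Y) = (⟨ω, inducedMk 1 y'⟩ : SigmaCarrier hQ X Y) at h1
    have h2 := eq_of_heq (Sigma.mk.inj_iff.mp h1).2
    obtain ⟨k, hk1, hk2⟩ := inducedMk_eq_iff.mp h2
    have hk : k = 1 := by
      have : ((stab X (Quot.out ω)).subtype k)⁻¹ = 1 := by
        rw [one_mul] at hk1
        exact hk1.symm
      exact Subtype.ext (inv_eq_one.mp this)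
    rw [hk2, hk]
    exact (ρ_one_apply (Y ω) y).symm
  · rintro ⟨⟨ω', c⟩, hc⟩
    induction c using Quotient.ind with
    | _ p =>
      obtain ⟨q, y⟩ := p
      have hc' : X.obj.ρ q (Quot.out ω') = Quot.out ω := hc
      have hω : ω' = ω := by
        rw [← Quot.out_eq ω', ← Quot.out_eq ω]
        change cl X (Quot.out ω') = cl X (Quot.out ω)
        rw [← hc', cl_ρ]
      subst hω
      refine ⟨(Y ω').obj.ρ ⟨q, hc'⟩ y, Subtype.ext ?_⟩
      change (⟨ω', (inducedMk 1 ((Y ω').obj.ρ ⟨q, hc'⟩ y) :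
          InducedSet (stab X (Quot.out ω')).subtype (Y ω'))⟩ : SigmaCarrier hQ X Y) =
        (⟨ω', Quotient.mk _ (q, y)⟩ : SigmaCarrier hQ X Y)
      rw [← inducedMk_mul, one_mul]
      rfl

/-- `fibreFamily X` is essentially surjective (when the open subgroups of `Π` have countable index,
e.g. `Π` profinite or second countable). [cite: MochizukiSemiAnbd2006, Prop 3.6(v) p.39] -/
theorem fibreFamily_essSurj (hQ : ∀ U : Subgroup G, IsOpen (U : Set G) → Countable (G ⧸ U))
    (X : BTemp G) : (fibreFamily X).EssSurj :=
  ⟨fun Y => ⟨sigmaInducedOver hQ X Y, ⟨{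
      hom := fun ω => (isoOfBijective (toSigmaFibre hQ X Y ω) (toSigmaFibre_bijective hQ X Y ω)).inv
      inv := fun ω => toSigmaFibre hQ X Y ω
      hom_inv_id := by
        funext ω
        exact (isoOfBijective _ (toSigmaFibre_bijective hQ X Y ω)).inv_hom_id
      inv_hom_id := by
        funext ω
        exact (isoOfBijective _ (toSigmaFibre_bijective hQ X Y ω)).hom_inv_id }⟩⟩⟩

/-- `fibreFamily X` is an equivalence (under the countable-index hypothesis).
[cite: MochizukiSemiAnbd2006, Prop 3.6(v) p.39] -/
theorem fibreFamily_isEquivalence (hQ : ∀ U : Subgroup G, IsOpen (U : Set G) → Countable (G ⧸ U))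
    (X : BTemp G) : (fibreFamily X).IsEquivalence :=
  haveI := fibreFamily_essSurj hQ X
  { }

end EssSurj

section Compact

variable [IsTopologicalGroup G] [CompactSpace G]

/-- Open subgroups of a profinite (compact) group have finite, hence countable, index.
[cite: MochizukiSemiAnbd2006, Rmk 3.1.1 p.33] -/
private theorem countable_quotient_of_isOpen (U : Subgroup G) (hU : IsOpen (U : Set G)) :
    Countable (G ⧸ U) :=
  haveI := Subgroup.quotient_finite_of_isOpen U hU
  inferInstance

/-- For profinite `Π`, `fibreFamily X` is an equivalence. [cite: MochizukiSemiAnbd2006, Prop 3.6(v) p.39] -/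
instance fibreFamily_isEquivalence_of_compact (X : BTemp G) :
    (fibreFamily X).IsEquivalence :=
  fibreFamily_isEquivalence (fun U hU => countable_quotient_of_isOpen U hU) X

/-- **`B^temp(Π)_X ≌ ∏_ω B^temp(Stab(x_ω))`** for profinite `Π`, with EXPLICIT functor the
fibre family. [cite: MochizukiSemiAnbd2006, Prop 3.6(v) p.39] -/
def fibreEquiv (X : BTemp G) : Over X ≌ ∀ ω : Orbits X, BTemp (stab X (Quot.out ω)) :=
  (fibreFamily X).asEquivalence

end Compact

end BTemp

end Literature.AnabelianGeometry.SemiGraphs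

end
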